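import Summits.Ventures.LatticeQCDFlow.Scaling.DominatedStarAugmentation
import Summits.Ventures.LatticeQCDFlow.Scaling.ProductRefreshCeiling

/-!
HONEST FRAMING: exact (Metropolis-corrected) sampling algorithms for lattice gauge theory; figures
of merit are autocorrelation/cost numbers at stated couplings and volumes; no continuum-physics
claim.

# DominatedStarFreshStep — CLEAN COORDINATES STAY EXACTLY DISTRIBUTED, PIECE BY PIECE: FOR A LAW `λ` ON
# `(configuration, stale set)` WITH `λ(z[j ↦ v], D)·μ_j(z_j) = λ(z, D)·μ_j(v)` (`j ∉ D`), (i) A SWAP ATTEMPT BETWEEN TWO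
# CLEAN LEVELS LEAVES `λ(·, D)` INVARIANT (PAIR DETAILED BALANCE), (ii) THE REGENERATION PART OF A FRESH-HUB SWAP ONTO
# A STALE LEVEL `l` IS EXACTLY `μ_l`-DISTRIBUTED AT `l`, (iii) ITS REVERSE IS EXACTLY `μ_0`-DISTRIBUTED AT THE HUB,
# (iv) STATIONARY SINGLE-SITE UPDATES AND THE EXACT HOT SAMPLER PRESERVE THE RELATION (lean-2 GEN-25, ours)

Venture-side (OURS).  Cell `lqcd-flow` (pub-lqcd), unit `pub-lqcd-lean-2-g25`, 2026-08-27.  Chapter M (the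
coupon-collector ceiling without perfect transports), file 5 — the local identities behind the freshness invariant of
`Scaling/DominatedStarFreshness`.  Setting of `Scaling/DominatedStarEntrySwap` (hub entries `r`, cold level
`l = κ_r+1`, proposal `y_r`, acceptance `α_r`, regeneration weights `β_r`, `β'_r`).  FRESH-EXCHANGEABILITY of a
function `λ` on `(Fin (K+1) → S) × Finset (Fin (K+1))`: `λ(z[j ↦ v], D)·μ_j(z_j) = λ(z, D)·μ_j(v)` for all `j ∉ D`
("given everything else, including the tag, a clean coordinate is exactly `μ_j`-distributed").

## What is proved

* §1 the entry pieces: `accept_update_of_ne` (`α_r` ignores coordinates off `{0, l}`), `entrySwap_update_of_ne`,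
  **`fresh_pair_swap`** (`λ(y_r z', D)·μ_0(z'_0)μ_l(z'_l) = λ(z', D)·μ_0((y_r z')_0)μ_l((y_r z')_l)` for `0, l ∉ D`),
  **`fresh_pair_balance`** (`λ(y_r z', D)·α_r(y_r z') = λ(z', D)·α_r(z')`), **`fresh_pair_step`**
  (`λ(y_r z', D)α_r(y_r z') + λ(z', D)(1 − α_r(z')) = λ(z', D)`), **`fresh_regen_fwd`** (the piece
  `z' ↦ λ(y_r z', D)·β_r(y_r z')` is fresh at `l` when `0 ∉ D`), **`fresh_regen_bwd`** (the piece
  `z' ↦ λ(y_r z', D)·β'_r(y_r z')` is fresh at `0` when `l ∉ D`), `fresh_generic_swap` (any piece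
  `z' ↦ λ(y_r z', D)·c(y_r z')` or `λ(z', D)·c(z')` with `c` supported on `{0,l}` is fresh at `j ∉ D ∪ {0, l}`).
* §2 the update pieces: **`fresh_hot_update`** (`z' ↦ Σ_u λ(z'[0 ↦ u], D)·μ_0(z'_0)` is fresh at every
  `j ∉ D ∖ {0}`), **`fresh_cold_update`** (`z' ↦ Σ_u λ(z'[k ↦ u], D)·M_k(u, z'_k)` is fresh at every `j ∉ D` when
  `M_k` is `μ_k`-stationary, `k ≠ 0`).

Reading (no numerics implied): these are the four conservation laws of exactness the augmented chain is built
from.  NOT CLAIMED here: the induction over time (the sequel).  Literature grade (cell rule): OWN COMPOSITION;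
nothing cited as a fact; no new bib keys.
-/

noncomputable section

open Finset Function
open Literature.Probability.MarkovChains

namespace Summit.Ventures.LatticeQCDFlow.Scaling

variable {S : Type*} [Fintype S] [DecidableEq S] {K m : ℕ} {μ : Fin (K + 1) → S → ℝ} {M : Fin (K + 1) → S → S → ℝ}
  {p q : ℝ}

section FreshStep
variable (κ : Fin m → Fin K) (φ : Fin m → Equiv.Perm S)

/-! ## §1 The entry pieces -/

omit [Fintype S] [DecidableEq S] in
/-- The proposal commutes with an update off the edge: `y_r(z[j ↦ v]) = (y_r z)[j ↦ v]` (`j ≠ 0, l`). [ours] -/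
theorem entrySwap_update_of_ne (r : Fin m) (z : Fin (K + 1) → S) {j : Fin (K + 1)} (hj0 : j ≠ 0)
    (hjl : j ≠ (κ r).succ) (v : S) :
    edgeFlowSwap (φ r) 0 (κ r).succ (update z j v) = update (edgeFlowSwap (φ r) 0 (κ r).succ z) j v := by
  unfold edgeFlowSwap
  rw [update_of_ne hjl.symm, update_of_ne hj0.symm, update_comm hj0, update_comm hjl]

omit [Fintype S] [DecidableEq S] in
/-- The proposal at the hub coordinate and at `l`: `(y_r z)_0 = φ_r⁻¹ z_l`, `(y_r z)_l = φ_r z_0`, and off the edge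
`(y_r z)_j = z_j`. [ours] -/
theorem entrySwap_apply (r : Fin m) (z : Fin (K + 1) → S) :
    edgeFlowSwap (φ r) 0 (κ r).succ z 0 = (φ r).symm (z (κ r).succ)
      ∧ edgeFlowSwap (φ r) 0 (κ r).succ z (κ r).succ = φ r (z 0)
      ∧ ∀ j : Fin (K + 1), j ≠ 0 → j ≠ (κ r).succ → edgeFlowSwap (φ r) 0 (κ r).succ z j = z j :=
  ⟨edgeFlowSwap_fst (φ r) (hubList_fst_ne_snd (K := K) κ r) z, edgeFlowSwap_snd (φ r) 0 (κ r).succ z,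
    fun _ hj0 hjl => edgeFlowSwap_of_ne (φ r) 0 (κ r).succ z hj0 hjl⟩

omit [Fintype S] [DecidableEq S] in
/-- Updating the hub coordinate of a proposal: `y_r(z[l ↦ v]) = (y_r z)[0 ↦ φ_r⁻¹ v]`. [ours] -/
theorem entrySwap_update_snd (r : Fin m) (z : Fin (K + 1) → S) (v : S) :
    edgeFlowSwap (φ r) 0 (κ r).succ (update z (κ r).succ v) = update (edgeFlowSwap (φ r) 0 (κ r).succ z) 0 ((φ r).symm v) := by
  have hl0 : (κ r).succ ≠ (0 : Fin (K + 1)) := Fin.succ_ne_zero _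
  unfold edgeFlowSwap
  rw [update_self, update_of_ne hl0.symm, update_comm hl0.symm ((φ r).symm (z (κ r).succ)) (φ r (z 0)) z,
    update_idem, update_comm hl0 v ((φ r).symm v) z, update_idem, update_comm hl0.symm ((φ r).symm v) (φ r (z 0)) z]

omit [Fintype S] [DecidableEq S] in
/-- Updating the cold coordinate of a proposal: `y_r(z[0 ↦ v]) = (y_r z)[l ↦ φ_r v]`. [ours] -/
theorem entrySwap_update_fst (r : Fin m) (z : Fin (K + 1) → S) (v : S) :
    edgeFlowSwap (φ r) 0 (κ r).succ (update z 0 v) = update (edgeFlowSwap (φ r) 0 (κ r).succ z) (κ r).succ (φ r v) := by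
  have hl0 : (κ r).succ ≠ (0 : Fin (K + 1)) := Fin.succ_ne_zero _
  unfold edgeFlowSwap
  rw [update_self, update_of_ne hl0, update_idem, update_idem]

omit [Fintype S] [DecidableEq S] in
/-- **The acceptance ignores coordinates off the edge:** `α_r(z[j ↦ v]) = α_r(z)` for `j ≠ 0, l` (`μ > 0`). [ours] -/
theorem accept_update_of_ne [Fintype S] [DecidableEq S] (hμ : ∀ k x, 0 < μ k x) {α : Fin m → (Fin (K + 1) → S) → ℝ}
    (hα : ∀ r z, α r z = min 1 (tensorFun μ (edgeFlowSwap (φ r) 0 (κ r).succ z) / tensorFun μ z))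
    (r : Fin m) (z : Fin (K + 1) → S) {j : Fin (K + 1)} (hj0 : j ≠ 0) (hjl : j ≠ (κ r).succ) (v : S) :
    α r (update z j v) = α r z := by
  have hA : 0 < μ 0 (z 0) * μ (κ r).succ (z (κ r).succ) := mul_pos (hμ _ _) (hμ _ _)
  have h1 := accept_mul_pair κ φ hμ hα r (update z j v)
  have h2 := accept_mul_pair κ φ hμ hα r z
  rw [update_of_ne hj0.symm, update_of_ne hjl.symm] at h1
  exact mul_right_cancel₀ hA.ne' (h1.trans h2.symm)

omit [Fintype S] [DecidableEq S] in
/-- **PAIR SWAP OF A FRESH PAIR:** if `λ` is fresh at `0` and at `l` on the tag `D` (`0, l ∉ D`), then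
`λ(y_r z', D)·μ_0(z'_0)·μ_l(z'_l) = λ(z', D)·μ_0((y_r z')_0)·μ_l((y_r z')_l)`. [ours] -/
theorem fresh_pair_swap {lam : (Fin (K + 1) → S) × Finset (Fin (K + 1)) → ℝ} {D : Finset (Fin (K + 1))}
    (hlam : ∀ (z : Fin (K + 1) → S) (j : Fin (K + 1)) (v : S), j ∉ D →
      lam (update z j v, D) * μ j (z j) = lam (z, D) * μ j v)
    (r : Fin m) (h0 : (0 : Fin (K + 1)) ∉ D) (hl : (κ r).succ ∉ D) (z' : Fin (K + 1) → S) :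
    lam (edgeFlowSwap (φ r) 0 (κ r).succ z', D) * (μ 0 (z' 0) * μ (κ r).succ (z' (κ r).succ))
      = lam (z', D) * (μ 0 ((φ r).symm (z' (κ r).succ)) * μ (κ r).succ (φ r (z' 0))) := by
  have hl0 : (κ r).succ ≠ (0 : Fin (K + 1)) := Fin.succ_ne_zero _
  -- `y = z'[0 ↦ a][l ↦ b]`
  have h1 := hlam z' 0 ((φ r).symm (z' (κ r).succ)) h0
  have h2 := hlam (update z' 0 ((φ r).symm (z' (κ r).succ))) (κ r).succ (φ r (z' 0)) hl
  rw [update_of_ne hl0] at h2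
  unfold edgeFlowSwap
  calc lam (update (update z' 0 ((φ r).symm (z' (κ r).succ))) (κ r).succ (φ r (z' 0)), D)
        * (μ 0 (z' 0) * μ (κ r).succ (z' (κ r).succ))
      = (lam (update (update z' 0 ((φ r).symm (z' (κ r).succ))) (κ r).succ (φ r (z' 0)), D)
          * μ (κ r).succ (z' (κ r).succ)) * μ 0 (z' 0) := by ring
    _ = (lam (update z' 0 ((φ r).symm (z' (κ r).succ)), D) * μ (κ r).succ (φ r (z' 0))) * μ 0 (z' 0) := by rw [h2]
    _ = (lam (update z' 0 ((φ r).symm (z' (κ r).succ)), D) * μ 0 (z' 0)) * μ (κ r).succ (φ r (z' 0)) := by ring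
    _ = (lam (z', D) * μ 0 ((φ r).symm (z' (κ r).succ))) * μ (κ r).succ (φ r (z' 0)) := by rw [h1]
    _ = lam (z', D) * (μ 0 ((φ r).symm (z' (κ r).succ)) * μ (κ r).succ (φ r (z' 0))) := by ring

omit [DecidableEq S] in
/-- **PAIR DETAILED BALANCE ON A FRESH PAIR:** `λ(y_r z', D)·α_r(y_r z') = λ(z', D)·α_r(z')` (`0, l ∉ D`, `μ > 0`).
[ours] -/
theorem fresh_pair_balance (hμ : ∀ k x, 0 < μ k x) {α : Fin m → (Fin (K + 1) → S) → ℝ}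
    (hα : ∀ r z, α r z = min 1 (tensorFun μ (edgeFlowSwap (φ r) 0 (κ r).succ z) / tensorFun μ z))
    {lam : (Fin (K + 1) → S) × Finset (Fin (K + 1)) → ℝ} {D : Finset (Fin (K + 1))}
    (hlam : ∀ (z : Fin (K + 1) → S) (j : Fin (K + 1)) (v : S), j ∉ D →
      lam (update z j v, D) * μ j (z j) = lam (z, D) * μ j v)
    (r : Fin m) (h0 : (0 : Fin (K + 1)) ∉ D) (hl : (κ r).succ ∉ D) (z' : Fin (K + 1) → S) :
    lam (edgeFlowSwap (φ r) 0 (κ r).succ z', D) * α r (edgeFlowSwap (φ r) 0 (κ r).succ z') = lam (z', D) * α r z' := by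
  set y := edgeFlowSwap (φ r) 0 (κ r).succ z' with hy
  have hinv : edgeFlowSwap (φ r) 0 (κ r).succ y = z' := entrySwap_entrySwap κ φ r z'
  have hy0 : y 0 = (φ r).symm (z' (κ r).succ) := (entrySwap_apply κ φ r z').1
  have hyl : y (κ r).succ = φ r (z' 0) := (entrySwap_apply κ φ r z').2.1
  -- `A = μ_0(z'_0)μ_l(z'_l)`, `A' = μ_0(y_0)μ_l(y_l)`
  have hA : 0 < μ 0 (z' 0) * μ (κ r).succ (z' (κ r).succ) := mul_pos (hμ _ _) (hμ _ _)
  have hA' : 0 < μ 0 (y 0) * μ (κ r).succ (y (κ r).succ) := mul_pos (hμ _ _) (hμ _ _)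
  have hφ1 : (φ r).symm (y (κ r).succ) = z' 0 := by rw [hyl, Equiv.symm_apply_apply]
  have hφ2 : φ r (y 0) = z' (κ r).succ := by rw [hy0, Equiv.apply_symm_apply]
  have h1 := accept_mul_pair κ φ hμ hα r y      -- `α(y)·A' = min(A', A)`
  rw [hφ1, hφ2] at h1
  have h2 := accept_mul_pair κ φ hμ hα r z'     -- `α(z')·A = min(A, A')`
  rw [← hy0, ← hyl] at h2
  have hsw := fresh_pair_swap κ φ hlam r h0 hl z'   -- `λ(y)·A = λ(z')·A'`
  rw [← hy, ← hy0, ← hyl] at hsw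
  -- multiply the goal by `A·A' > 0`
  refine mul_right_cancel₀ (mul_pos hA hA').ne' ?_
  calc lam (y, D) * α r y * (μ 0 (z' 0) * μ (κ r).succ (z' (κ r).succ) * (μ 0 (y 0) * μ (κ r).succ (y (κ r).succ)))
      = (lam (y, D) * (μ 0 (z' 0) * μ (κ r).succ (z' (κ r).succ)))
          * (α r y * (μ 0 (y 0) * μ (κ r).succ (y (κ r).succ))) := by ring
    _ = (lam (z', D) * (μ 0 (y 0) * μ (κ r).succ (y (κ r).succ)))
          * min (μ 0 (y 0) * μ (κ r).succ (y (κ r).succ)) (μ 0 (z' 0) * μ (κ r).succ (z' (κ r).succ)) := by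
        rw [hsw, h1]
    _ = (lam (z', D) * (μ 0 (y 0) * μ (κ r).succ (y (κ r).succ)))
          * min (μ 0 (z' 0) * μ (κ r).succ (z' (κ r).succ)) (μ 0 (y 0) * μ (κ r).succ (y (κ r).succ)) := by
        rw [min_comm]
    _ = lam (z', D) * (μ 0 (y 0) * μ (κ r).succ (y (κ r).succ))
          * (α r z' * (μ 0 (z' 0) * μ (κ r).succ (z' (κ r).succ))) := by rw [h2]
    _ = lam (z', D) * α r z' * (μ 0 (z' 0) * μ (κ r).succ (z' (κ r).succ) * (μ 0 (y 0) * μ (κ r).succ (y (κ r).succ))) := by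
        ring

omit [DecidableEq S] in
/-- **A SWAP ATTEMPT BETWEEN TWO CLEAN LEVELS LEAVES THE LAW INVARIANT:**
`λ(y_r z', D)·α_r(y_r z') + λ(z', D)·(1 − α_r(z')) = λ(z', D)` (`0, l ∉ D`). [ours] -/
theorem fresh_pair_step (hμ : ∀ k x, 0 < μ k x) {α : Fin m → (Fin (K + 1) → S) → ℝ}
    (hα : ∀ r z, α r z = min 1 (tensorFun μ (edgeFlowSwap (φ r) 0 (κ r).succ z) / tensorFun μ z))
    {lam : (Fin (K + 1) → S) × Finset (Fin (K + 1)) → ℝ} {D : Finset (Fin (K + 1))}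
    (hlam : ∀ (z : Fin (K + 1) → S) (j : Fin (K + 1)) (v : S), j ∉ D →
      lam (update z j v, D) * μ j (z j) = lam (z, D) * μ j v)
    (r : Fin m) (h0 : (0 : Fin (K + 1)) ∉ D) (hl : (κ r).succ ∉ D) (z' : Fin (K + 1) → S) :
    lam (edgeFlowSwap (φ r) 0 (κ r).succ z', D) * α r (edgeFlowSwap (φ r) 0 (κ r).succ z') + lam (z', D) * (1 - α r z')
      = lam (z', D) := by
  rw [fresh_pair_balance κ φ hμ hα hlam r h0 hl z']; ring

omit [Fintype S] [DecidableEq S] in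
/-- **THE FORWARD REGENERATION PIECE IS EXACTLY `μ_l`-DISTRIBUTED AT `l`:** if `λ(·, D)` is fresh at `0 ∉ D`, then
`T(z') = λ(y_r z', D)·β_r(y_r z')` satisfies `T(z'[l ↦ v])·μ_l(z'_l) = T(z')·μ_l(v)` (`μ > 0`). [ours] -/
theorem fresh_regen_fwd (hμ : ∀ k x, 0 < μ k x)
    {β : Fin m → (Fin (K + 1) → S) → ℝ} (hβ : ∀ r z, β r z = p * μ (κ r).succ (φ r (z 0)) / μ 0 (z 0))
    {lam : (Fin (K + 1) → S) × Finset (Fin (K + 1)) → ℝ} {D : Finset (Fin (K + 1))}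
    (hlam0 : ∀ (z : Fin (K + 1) → S) (v : S), lam (update z 0 v, D) * μ 0 (z 0) = lam (z, D) * μ 0 v)
    (r : Fin m) (z' : Fin (K + 1) → S) (v : S) :
    lam (edgeFlowSwap (φ r) 0 (κ r).succ (update z' (κ r).succ v), D)
        * β r (edgeFlowSwap (φ r) 0 (κ r).succ (update z' (κ r).succ v)) * μ (κ r).succ (z' (κ r).succ)
      = lam (edgeFlowSwap (φ r) 0 (κ r).succ z', D) * β r (edgeFlowSwap (φ r) 0 (κ r).succ z') * μ (κ r).succ v := by
  set y := edgeFlowSwap (φ r) 0 (κ r).succ z' with hy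
  have hy0 : y 0 = (φ r).symm (z' (κ r).succ) := (entrySwap_apply κ φ r z').1
  rw [entrySwap_update_snd κ φ r z' v, ← hy, hβ, hβ, update_self, hy0, Equiv.apply_symm_apply,
    Equiv.apply_symm_apply]
  have h := hlam0 y ((φ r).symm v)
  rw [hy0] at h
  have hpos1 := hμ 0 ((φ r).symm v)
  have hpos2 := hμ 0 ((φ r).symm (z' (κ r).succ))
  have h' : lam (update y 0 ((φ r).symm v), D) = lam (y, D) * μ 0 ((φ r).symm v) / μ 0 ((φ r).symm (z' (κ r).succ)) := by
    rw [eq_div_iff hpos2.ne']; exact h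
  rw [h']
  field_simp

omit [Fintype S] [DecidableEq S] in
/-- **THE REVERSE REGENERATION PIECE IS EXACTLY `μ_0`-DISTRIBUTED AT THE HUB:** if `λ(·, D)` is fresh at `l ∉ D`,
then `T(z') = λ(y_r z', D)·β'_r(y_r z')` satisfies `T(z'[0 ↦ v])·μ_0(z'_0) = T(z')·μ_0(v)` (`μ > 0`). [ours] -/
theorem fresh_regen_bwd (hμ : ∀ k x, 0 < μ k x)
    {β' : Fin m → (Fin (K + 1) → S) → ℝ}
    (hβ' : ∀ r z, β' r z = q * μ 0 ((φ r).symm (z (κ r).succ)) / μ (κ r).succ (z (κ r).succ))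
    {lam : (Fin (K + 1) → S) × Finset (Fin (K + 1)) → ℝ} {D : Finset (Fin (K + 1))} (r : Fin m)
    (hlaml : ∀ (z : Fin (K + 1) → S) (v : S),
      lam (update z (κ r).succ v, D) * μ (κ r).succ (z (κ r).succ) = lam (z, D) * μ (κ r).succ v)
    (z' : Fin (K + 1) → S) (v : S) :
    lam (edgeFlowSwap (φ r) 0 (κ r).succ (update z' 0 v), D)
        * β' r (edgeFlowSwap (φ r) 0 (κ r).succ (update z' 0 v)) * μ 0 (z' 0)
      = lam (edgeFlowSwap (φ r) 0 (κ r).succ z', D) * β' r (edgeFlowSwap (φ r) 0 (κ r).succ z') * μ 0 v := by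
  set y := edgeFlowSwap (φ r) 0 (κ r).succ z' with hy
  have hyl : y (κ r).succ = φ r (z' 0) := (entrySwap_apply κ φ r z').2.1
  rw [entrySwap_update_fst κ φ r z' v, ← hy, hβ', hβ', update_self, hyl, Equiv.symm_apply_apply,
    Equiv.symm_apply_apply]
  have h := hlaml y (φ r v)
  rw [hyl] at h
  have hpos1 := hμ (κ r).succ (φ r v)
  have hpos2 := hμ (κ r).succ (φ r (z' 0))
  have h' : lam (update y (κ r).succ (φ r v), D) = lam (y, D) * μ (κ r).succ (φ r v) / μ (κ r).succ (φ r (z' 0)) := by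
    rw [eq_div_iff hpos2.ne']; exact h
  rw [h']
  field_simp

/-! ## §2 The update pieces -/

omit [DecidableEq S] in
/-- **THE EXACT HOT SAMPLER KEEPS FRESHNESS:** `T(z') = Σ_u λ(z'[0 ↦ u], D)·μ_0(z'_0)` satisfies
`T(z'[j ↦ v])·μ_j(z'_j) = T(z')·μ_j(v)` at `j = 0`, and at every `j ≠ 0` at which `λ(·, D)` is fresh. [ours] -/
theorem fresh_hot_update {lam : (Fin (K + 1) → S) × Finset (Fin (K + 1)) → ℝ} {D : Finset (Fin (K + 1))}
    {j : Fin (K + 1)}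
    (hlamj : j ≠ 0 → ∀ (z : Fin (K + 1) → S) (v : S), lam (update z j v, D) * μ j (z j) = lam (z, D) * μ j v)
    (z' : Fin (K + 1) → S) (v : S) :
    (∑ u : S, lam (update (update z' j v) 0 u, D) * μ 0 (update z' j v 0)) * μ j (z' j)
      = (∑ u : S, lam (update z' 0 u, D) * μ 0 (z' 0)) * μ j v := by
  by_cases hj : j = 0
  · subst hj
    simp_rw [update_idem, update_self]
    rw [Finset.sum_mul, Finset.sum_mul]
    exact sum_congr rfl fun u _ => by ring
  · rw [update_of_ne (Ne.symm hj), Finset.sum_mul, Finset.sum_mul]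
    refine sum_congr rfl fun u _ => ?_
    rw [update_comm hj]
    have h := hlamj hj (update z' 0 u) v
    rw [update_of_ne hj] at h
    calc lam (update (update z' 0 u) j v, D) * μ 0 (z' 0) * μ j (z' j)
        = (lam (update (update z' 0 u) j v, D) * μ j (z' j)) * μ 0 (z' 0) := by ring
      _ = (lam (update z' 0 u, D) * μ j v) * μ 0 (z' 0) := by rw [h]
      _ = lam (update z' 0 u, D) * μ 0 (z' 0) * μ j v := by ring

omit [DecidableEq S] in
/-- **A STATIONARY SINGLE-SITE UPDATE AT `k ≠ 0` KEEPS FRESHNESS:** with `Σ_u μ_k(u)M_k(u,v) = μ_k(v)` and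
`λ(·, D)` fresh at every `j ∉ D` (`k ∉ D` or not), `T(z') = Σ_u λ(z'[k ↦ u], D)·M_k(u, z'_k)` satisfies
`T(z'[j ↦ v])·μ_j(z'_j) = T(z')·μ_j(v)` for every `j ∉ D` (`μ_k > 0`). [ours] -/
theorem fresh_cold_update (hμ : ∀ k x, 0 < μ k x) {k : Fin (K + 1)} (hstat : ∀ v, ∑ u, μ k u * M k u v = μ k v)
    {lam : (Fin (K + 1) → S) × Finset (Fin (K + 1)) → ℝ} {D : Finset (Fin (K + 1))}
    (hlam : ∀ (z : Fin (K + 1) → S) (j : Fin (K + 1)) (v : S), j ∉ D →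
      lam (update z j v, D) * μ j (z j) = lam (z, D) * μ j v)
    (z' : Fin (K + 1) → S) {j : Fin (K + 1)} (hj : j ∉ D) (v : S) :
    (∑ u : S, lam (update (update z' j v) k u, D) * M k u (update z' j v k)) * μ j (z' j)
      = (∑ u : S, lam (update z' k u, D) * M k u (z' k)) * μ j v := by
  by_cases hjk : j = k
  · subst hjk
    simp_rw [update_idem, update_self]
    -- `λ(z'[j ↦ u], D) = λ(z', D)·μ_j(u)/μ_j(z'_j)`
    have hz : 0 < μ j (z' j) := hμ _ _
    have key : ∀ u, lam (update z' j u, D) = lam (z', D) * μ j u / μ j (z' j) := fun u => by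
      rw [eq_div_iff hz.ne']; exact hlam z' j u hj
    simp_rw [key]
    have e1 : ∑ u, lam (z', D) * μ j u / μ j (z' j) * M j u v = lam (z', D) / μ j (z' j) * ∑ u, μ j u * M j u v := by
      rw [Finset.mul_sum]; exact sum_congr rfl fun u _ => by ring
    have e2 : ∑ u, lam (z', D) * μ j u / μ j (z' j) * M j u (z' j)
        = lam (z', D) / μ j (z' j) * ∑ u, μ j u * M j u (z' j) := by
      rw [Finset.mul_sum]; exact sum_congr rfl fun u _ => by ring
    rw [e1, e2, hstat, hstat]
    field_simp
  · rw [update_of_ne (Ne.symm hjk), Finset.sum_mul, Finset.sum_mul]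
    refine sum_congr rfl fun u _ => ?_
    rw [update_comm hjk]
    have h := hlam (update z' k u) j v hj
    rw [update_of_ne hjk] at h
    calc lam (update (update z' k u) j v, D) * M k u (z' k) * μ j (z' j)
        = (lam (update (update z' k u) j v, D) * μ j (z' j)) * M k u (z' k) := by ring
      _ = (lam (update z' k u, D) * μ j v) * M k u (z' k) := by rw [h]
      _ = lam (update z' k u, D) * M k u (z' k) * μ j v := by ring

end FreshStep

end Summit.Ventures.LatticeQCDFlow.Scaling

end
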